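import Summits.QuantumFields.BalabanUV.Beta.GAN24.CombLegTowerWindowSources
import Summits.QuantumFields.BalabanUV.Beta.GAN24.LegSourceRuledClass
import Summits.QuantumFields.BalabanUV.Beta.GAN24.CombT2DriftEvenEnd
import Summits.QuantumFields.BalabanUV.Beta.GAN24.CombRelSourceHalfCharge

/-!
# `BalabanUV.Beta.GAN24.CombLegSourceRuledClass` — binder row G-an2-4 ∕ (CONV-C), TRANSFER-III (the (α-0) chain at row D1's literal of record (III′)),
# row L11 (Q-L), CONSUMER SIDE: **THE RULED-CLASS MEMBERSHIPS AT THE COMB-CHART DATA — THE (III′) TWINS OF MY (E) FILES `LegRowsOnRuledClass` §2 AND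
# `LegSourceRuledClass` §1–§3**: the leg letters `rdiv ∘ y′_n` of the `ε`-member `y′_n = ½ • (T̃′♮_n + ε • P T̃′♮_n)` of the comb-chart `T₂` tower, their drifts, the
# source letters `rdiv ∘ F′^ε_l` (`F′^ε_l = ½ • (b̃′♮_l + ε • P b̃′♮_l)`, road-P2's (F1) dressed source at the comb letters), the kernel-drift and source-drift
# letters are ALL in the ruled class `𝒫 W :≡ (jointly Lc-covariant) ∧ (∀ N′ κ κ′ a b, zmode N′ W κ κ′ a b = 0) ∧ (∃ C′ δ′ > 0, LocStencil₂ W C′ δ′)` — so W3's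
# windows are displayed on EXACTLY that class (G-an2-4 CRUX TEAM (2), leaf prover `b2b-balaban-gan24-formalise-leaf-03`, gen 81; FILE W2 of the journal INTENT
# [LEAF03-G81-INTENT-1]; the OWNER gan24-p1 g46's link table R-gan24p1-g46-2, row «L11–L13»; over W1 `CombLegTowerWindowSources`, MY (E) `LegSourceRuledClass`
# (generic §1: `ruledClass_add ∕ _sub`; `LegRowsOnRuledClass.legLetter_mem_ruledClass`) and the OWNER's T5 `CombT2DriftEvenEnd` §1; no existing file touched)

NOT IN PRINT; OUR BOOKKEEPING ([folklore] composition BY NAME; the §1–§4 statements are the (E) files' with `(coDressKBmAt ρ Lc (KInvStep Lc ·), T2RecAt ρ, SpureRecAt ρ,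
M1At ρ cΛ, vh₂S, mixFFAt ρ Lc) ↦ (GcombSh Lc ·, T2RecOf … (GcombSh Lc) (SpureCombOf tabs …) tabs.M …, SpureCombOf tabs, tabs.M, tabs.vh₂S, tabs.mixFF)`, the root ∕ class ∕
covariance binders `hLc hr hB hBt` ↦ the record `tabs : SymTables d Lc` (its `tabs.hB ∕ tabs.hBt ∕ tabs.hM ∕ tabs.hmix`); proofs token for token with the input map of §0;
0 `def`, 0 cited facts, 0 `def … : Prop`, 0 sorry).  HONEST FRAMING (cell contract, verbatim): «discharging `BetaPertH` makes Bałaban's UV stability UNCONDITIONAL — a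
real constructive-QFT result; it is NOT the continuum limit and NOT the Clay problem.»  HONEST DEPENDENCY (verbatim): «continuum YM on T⁴ ⇐ BetaPertH ∧ nine spine
estimates (0/9 proved); BetaPertH ⇐ (D1) ∧ (D4) ∧ CAP+tail; G-an2-4 gates asym, D1 and NE2/3/4.»

OBJECTS (EXACTLY as in the OWNER's T5 §1): comb-chart literal `T̃′_j := T2RecOf d Lc (GcombSh Lc) (SpureCombOf tabs cE cVH cΛ) tabs.M cE₂ cB Tc tabs.vh₂S tabs.mixFF j`, unit
member `T̃′♮_j := unitS₂ (sfStep Lc j) (smStep d Lc j) T̃′_j`, comb-chart unit step kernel `G′♮_j := unitK (sfStep Lc j) (smStep d Lc j) (GcombSh Lc j)`, `c₄ := cE₂·Lc^{2(d+1)}`,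
road-P2's (F1) dressed source `b̃′♮_j`, the slotwise parity `P T κ u κ′ u′ := sgnK (trK (T κ u κ′ u′))`; any record `tabs : SymTables d Lc` with off-diagonal border `hBff hBmm`
where the source enters; generic `d`, `Lc ≥ 1` via `[NeZero Lc]`; every `ε` with `|ε| ≤ 1` where the class needs it.
* §0 (III′) inputs: the members' `LocStencil₂` class is leaf-01 g80's `CombRelSourceHalfCharge.locStencil₂_unitS₂_T2RecOf_comb` BY NAME (v1.3; v1.1's local copy
  `exists_locStencil₂_unitS₂_T2RecOf_comb` survives as a deprecated alias — append-only), `bdd₄_unitS₂_T2RecOf_comb`, the (F1) step `succ_combChart` (road-P2's `unitS₂_T2RecOf_succ_eq_lin4_add` with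
  `step_data_of_letters` — the device the OWNER's T5 and leaf-01's (III′) files inline; the twin of an2–leaf-01's `T2DevCovariance.succ_comb_dressed`), `bdd₄_source_combChart`
  (leaf-01's `bdd₄_source_of_letters`), `source_combChart_translate` (the twin of `T2DevCovariance.source_comb_dressed_translate`: tower covariance
  `CombT2DriftEvenEnd.unitS₂_T2RecOf_comb_translate` + leaf-18's `lin4_translate` at W1's `shiftK_unitK_GcombSh`).
* §1 **`legStepB_rdiv_eq_GcombSh`** ∕ **`legStepB_rdiv_mem_GcombSh`** — one comb-chart leg step maps the leg letter of a bounded table to the leg letter of its one-step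
  image, and keeps the leg letter of a covariant `LocStencil₂` table in 𝒫, at EVERY step `j`.
* §2 `halfMember_comb_translate`, **`halfMember_comb_legLetter_mem`**, **`halfMember_comb_legDrift_mem`** — `𝒫 (rdiv ∘ y′_n)`, `𝒫 (rdiv ∘ y′_{n+1} − rdiv ∘ y′_n)`.
* §3 `halfSource_comb_translate`, `exists_locStencil₂_source_combChart`, `exists_locStencil₂_halfSource_comb`, **`halfSource_comb_legLetter_mem`** — `𝒫 (rdiv ∘ F′^ε_l)`.
* §4 **`halfDiffSource_comb_mem`**, **`halfKernelDrift_comb_mem`**, **`halfSourceDrift_comb_mem`** — W1's drift-END memberships `hSP ∕ hKP` at the member.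
Asserts NO bound uniform in the level and NO value of Bałaban's tables; discharges NOTHING of (Q-L) ∕ (C) ∕ «T2Shape» ∕ «T2Drift» ∕ (hW, hWall); the (III′) campaign is NOT
asked (an2 W-4); NEVER «G-an2-4 closed» as (CONV-C); NOT D1, NOT `BetaPertH`, NOT continuum, NOT Clay; not in print.  Unit `b2b-balaban-gan24-formalise-leaf-03` (gen 81),
2026-08-25.
-/

noncomputable section
open Finset
open scoped BigOperators
open Literature.MathematicalPhysics.QuantumFieldTheory
open Literature.MathematicalPhysics.QuantumFieldTheory.Balaban1983to89
open Literature.MathematicalPhysics.QuantumFieldTheory.Balaban1983to89.Beta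
open ExpKernelCalculus (MKer Site Decays shiftK)
open OneStepResolventKernel (Fib LocStencil)
open OneStepKernelFamily (KInvStep)
open AffineAveraging (box toSite unitVec)
open SecondOrderResponse (W2SymOfK)
open BalabanCompositeJets (LocStencil₂ LocStencil₂.mono)
open BalabanStepJetsSucc (mmRead)
open BalabanStepW2 (K3OfK M2Of)
open Summit.QuantumFields.BalabanUV.Beta.TameKernelCalculus (trK)
open Summit.QuantumFields.BalabanUV.Beta.BorderedHessian (sgnK)
open Summit.QuantumFields.BalabanUV.Beta.HessKerDressedUnits (unitK unitS decays_unitK)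
open Summit.QuantumFields.BalabanUV.Beta.SecondOrderUnits (unitM unitS₂ unitM₂)
open Summit.QuantumFields.BalabanUV.Beta.AxialDressingRooted (one_le_of_neZero)
open Summit.QuantumFields.BalabanUV.Beta.SpineRooted (T2RecOf T2RecOf_loc)
open Summit.QuantumFields.BalabanUV.Beta.SymmetrisedStepJets (SymTables)
open Summit.QuantumFields.BalabanUV.Beta.CombChartStepJets (GcombSh decays_GcombSh SpureCombOf locStencil_SpureCombOf)
open Summit.QuantumFields.BalabanUV.Beta.GAN24.CombesThomas (sfStep smStep)
open Summit.QuantumFields.BalabanUV.Beta.GAN24.T2RecursionAffine (lin4)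
open Summit.QuantumFields.BalabanUV.Beta.GAN24.BiStencilZeroMode (zmode)
open Summit.QuantumFields.BalabanUV.Beta.GAN24.Lin4LegTower (rdiv)
open Summit.QuantumFields.BalabanUV.Beta.GAN24.Lin4LegTowerUnroll (legStepB)
open Summit.QuantumFields.BalabanUV.Beta.GAN24.T2UnitSplitShapes (bdd₄_of_locStencil₂)
open Summit.QuantumFields.BalabanUV.Beta.GAN24.T2RecOfUnitSplit (unitS₂_T2RecOf_succ_eq_lin4_add step_data_of_letters)
open Summit.QuantumFields.BalabanUV.Beta.GAN24.T2RecHybridSplit (bdd₄_source_of_letters)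
open Summit.QuantumFields.BalabanUV.Beta.GAN24.BiTableParityHalves (biLoc_half covariant_half locStencil₂_half)
open Summit.QuantumFields.BalabanUV.Beta.GAN24.WSlotFirstDiff (locStencil₂_unitS₂)
open Summit.QuantumFields.BalabanUV.Beta.GAN24.WSlotForcingZeroModeW3 (sub_translate_pi)
open Summit.QuantumFields.BalabanUV.Beta.GAN24.Lin4ZeroMode (lin4_translate locStencil₂_lin4)
open Summit.QuantumFields.BalabanUV.Beta.GAN24.LegDriftRowsOfLegChain (rdiv_comp_sub)
open Summit.QuantumFields.BalabanUV.Beta.GAN24.LegFirstWindowRows (locStencil₂_sub locStencil₂_rdiv)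
open Summit.QuantumFields.BalabanUV.Beta.GAN24.LegSlotDivergenceCommute (rdiv_zero)
open Summit.QuantumFields.BalabanUV.Beta.GAN24.LegRowsOnRuledClass (legLetter_mem_ruledClass)
open Summit.QuantumFields.BalabanUV.Beta.GAN24.LegSourceRuledClass (ruledClass_add ruledClass_sub)
open Summit.QuantumFields.BalabanUV.Beta.GAN24.CombT2DriftEvenEnd (unitS₂_T2RecOf_comb_translate)
open Summit.QuantumFields.BalabanUV.Beta.GAN24.CombLegTowerWindowSources (shiftK_unitK_GcombSh rdiv_lin4_affine_GcombSh)
open Summit.QuantumFields.BalabanUV.Beta.GAN24.CombRelSourceHalfCharge (locStencil₂_unitS₂_T2RecOf_comb)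

namespace Summit.QuantumFields.BalabanUV.Beta.GAN24.CombLegSourceRuledClass

variable {d : ℕ} {Lc : ℕ} [NeZero Lc]

/-! ## §0 The (III′) inputs: the comb-chart unit members and the (F1) source — `LocStencil₂`, bounded, covariant -/

/-- DEPRECATED ALIAS (v1.3) of leaf-01 g80's `CombRelSourceHalfCharge.locStencil₂_unitS₂_T2RecOf_comb` (p403423 ✓ — the identical statement up to bound names, landed in
the SAME gate commit 046b2daaeb0a as v1.1 of this file; the (α) dedup resolution of the journal, l.66533 ∕ l.66693): kept only because landed files are append-only, now PROVED BY
that declaration and used nowhere in this file or its importers.  [folklore] every comb-chart unit member `T̃′♮_j` is `LocStencil₂` at a positive rate. -/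
@[deprecated locStencil₂_unitS₂_T2RecOf_comb (since := "2026-08-25")]
theorem exists_locStencil₂_unitS₂_T2RecOf_comb (tabs : SymTables d Lc) (cE cVH cΛ cE₂ cB : ℝ) (Tc : Fin 4 → Fin 4 → Fin 4 → Fin 4 → ℝ) (j : ℕ) :
    ∃ C δ : ℝ, 0 < δ ∧ LocStencil₂ (unitS₂ (sfStep Lc j) (smStep d Lc j) (T2RecOf d Lc (GcombSh Lc) (SpureCombOf tabs cE cVH cΛ) tabs.M cE₂ cB Tc tabs.vh₂S tabs.mixFF j)) C δ :=
  locStencil₂_unitS₂_T2RecOf_comb tabs cE cVH cΛ cE₂ cB Tc j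

/-- [folklore] **EVERY COMB-CHART UNIT MEMBER IS BOUNDED** (leaf-01's `locStencil₂_unitS₂_T2RecOf_comb` ⨾ `bdd₄_of_locStencil₂`); the twin of MY (E) `LegLetterRowsOfLegChain.bdd₄_unitS₂_T2RecAt`. -/
theorem bdd₄_unitS₂_T2RecOf_comb (tabs : SymTables d Lc) (cE cVH cΛ cE₂ cB : ℝ) (Tc : Fin 4 → Fin 4 → Fin 4 → Fin 4 → ℝ) (j : ℕ) :
    ∃ B : ℝ, ∀ κ u κ' u' x z a b, |(unitS₂ (sfStep Lc j) (smStep d Lc j) (T2RecOf d Lc (GcombSh Lc) (SpureCombOf tabs cE cVH cΛ) tabs.M cE₂ cB Tc tabs.vh₂S tabs.mixFF j)) κ u κ' u' x z a b| ≤ B := by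
  obtain ⟨C, δ, hδ, h⟩ := locStencil₂_unitS₂_T2RecOf_comb tabs cE cVH cΛ cE₂ cB Tc j
  exact bdd₄_of_locStencil₂ h hδ.le

/-- [folklore] **THE (F1) STEP AT THE COMB-CHART LETTERS**: `T̃′♮_{j+1} = lin4 c₄ G′♮_j Lc T̃′♮_j + b̃′♮_j` (road-P2's slot-generic `unitS₂_T2RecOf_succ_eq_lin4_add` with
`step_data_of_letters` at an2's `decays_GcombSh` ∕ `locStencil_SpureCombOf` and the record's `hM ∕ hB ∕ hmix` — the device the OWNER's T5 `halfMember_comb_succ_eq` inlines);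
the twin of an2–leaf-01's `T2DevCovariance.succ_comb_dressed`. -/
theorem succ_combChart (tabs : SymTables d Lc) (cE cVH cΛ cE₂ cB : ℝ) (Tc : Fin 4 → Fin 4 → Fin 4 → Fin 4 → ℝ)
    (hBff : ∀ κ u κ' u' x z (α β : Fin (d + 1)), tabs.vh₂S κ u κ' u' x z (Sum.inl α) (Sum.inl β) = 0)
    (hBmm : ∀ κ u κ' u' x z (μ ν : Fin (d + 1)), tabs.vh₂S κ u κ' u' x z (Sum.inr μ) (Sum.inr ν) = 0) (j : ℕ) :
    unitS₂ (sfStep Lc (j + 1)) (smStep d Lc (j + 1)) (T2RecOf d Lc (GcombSh Lc) (SpureCombOf tabs cE cVH cΛ) tabs.M cE₂ cB Tc tabs.vh₂S tabs.mixFF (j + 1))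
      = lin4 (cE₂ * (Lc : ℝ) ^ (2 * (d + 1))) (unitK (sfStep Lc j) (smStep d Lc j) (GcombSh (d := d) Lc j)) Lc (unitS₂ (sfStep Lc j) (smStep d Lc j) (T2RecOf d Lc (GcombSh Lc) (SpureCombOf tabs cE cVH cΛ) tabs.M cE₂ cB Tc tabs.vh₂S tabs.mixFF j))
        + ((fun κ u κ' u' => (cE₂ * (Lc : ℝ) ^ (2 * (d + 1))) • mmRead Lc (K3OfK (unitK (sfStep Lc j) (smStep d Lc j) (GcombSh (d := d) Lc j)) Lc (unitS (sfStep Lc j) (smStep d Lc j) (SpureCombOf tabs cE cVH cΛ j)) (unitM (sfStep Lc j) (smStep d Lc j) (tabs.M j)) (W2SymOfK (unitK (sfStep Lc j) (smStep d Lc j) (GcombSh (d := d) Lc j)) Lc (unitS (sfStep Lc j) (smStep d Lc j) (SpureCombOf tabs cE cVH cΛ j)) (unitM (sfStep Lc j) (smStep d Lc j) (tabs.M j)) 0 (unitM₂ (sfStep Lc j) (smStep d Lc j) (M2Of d Lc tabs.mixFF j))) κ u κ' u') + cB • tabs.vh₂S κ u κ' u')) := by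
  obtain ⟨C, δ, C₀, C₁, hδ, hK, h₀, hW⟩ := step_data_of_letters (GcombSh Lc) (SpureCombOf tabs cE cVH cΛ) tabs.M cE₂ cB Tc (one_le_of_neZero Lc)
      (decays_GcombSh (d := d) Lc) (locStencil_SpureCombOf tabs cE cVH cΛ) tabs.hM tabs.hB tabs.hmix j
  exact unitS₂_T2RecOf_succ_eq_lin4_add (GcombSh Lc) (SpureCombOf tabs cE cVH cΛ) tabs.M cE₂ cB Tc tabs.vh₂S tabs.mixFF hBff hBmm j hδ hK h₀ hW

/-- [folklore] **THE (F1) DRESSED SOURCE AT THE COMB-CHART LETTERS IS BOUNDED** at every level (leaf-01's `T2RecHybridSplit.bdd₄_source_of_letters`); the twin of MY (E)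
`LegLetterRowsOfLegChain.bdd₄_source_comb`. -/
theorem bdd₄_source_combChart (tabs : SymTables d Lc) (cE cVH cΛ cE₂ cB : ℝ) (Tc : Fin 4 → Fin 4 → Fin 4 → Fin 4 → ℝ)
    (hBff : ∀ κ u κ' u' x z (α β : Fin (d + 1)), tabs.vh₂S κ u κ' u' x z (Sum.inl α) (Sum.inl β) = 0)
    (hBmm : ∀ κ u κ' u' x z (μ ν : Fin (d + 1)), tabs.vh₂S κ u κ' u' x z (Sum.inr μ) (Sum.inr ν) = 0) (l : ℕ) :
    ∃ B : ℝ, ∀ κ u κ' u' x z a b, |((fun κ u κ' u' => (cE₂ * (Lc : ℝ) ^ (2 * (d + 1))) • mmRead Lc (K3OfK (unitK (sfStep Lc l) (smStep d Lc l) (GcombSh (d := d) Lc l)) Lc (unitS (sfStep Lc l) (smStep d Lc l) (SpureCombOf tabs cE cVH cΛ l)) (unitM (sfStep Lc l) (smStep d Lc l) (tabs.M l)) (W2SymOfK (unitK (sfStep Lc l) (smStep d Lc l) (GcombSh (d := d) Lc l)) Lc (unitS (sfStep Lc l) (smStep d Lc l) (SpureCombOf tabs cE cVH cΛ l)) (unitM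 (sfStep Lc l) (smStep d Lc l) (tabs.M l)) 0 (unitM₂ (sfStep Lc l) (smStep d Lc l) (M2Of d Lc tabs.mixFF l))) κ u κ' u') + cB • tabs.vh₂S κ u κ' u')) κ u κ' u' x z a b| ≤ B :=
  bdd₄_source_of_letters (GcombSh Lc) (SpureCombOf tabs cE cVH cΛ) tabs.M cE₂ cB tabs.vh₂S tabs.mixFF Tc (one_le_of_neZero Lc) hBff hBmm
    (decays_GcombSh (d := d) Lc) (locStencil_SpureCombOf tabs cE cVH cΛ) tabs.hM tabs.hB tabs.hmix l

/-- [folklore] **THE (F1) DRESSED SOURCE AT THE COMB-CHART LETTERS IS JOINTLY `Lc`-COVARIANT** (as `T̃′♮_{j+1} − 𝒜^{G′}_j T̃′♮_j`: the OWNER's T5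
`unitS₂_T2RecOf_comb_translate` for both members, leaf-18's `lin4_translate` at W1's `shiftK_unitK_GcombSh`, leaf-18's `sub_translate_pi`); the twin of an2–leaf-01's
`T2DevCovariance.source_comb_dressed_translate`. -/
theorem source_combChart_translate (tabs : SymTables d Lc) (cE cVH cΛ cE₂ cB : ℝ) (Tc : Fin 4 → Fin 4 → Fin 4 → Fin 4 → ℝ)
    (hBff : ∀ κ u κ' u' x z (α β : Fin (d + 1)), tabs.vh₂S κ u κ' u' x z (Sum.inl α) (Sum.inl β) = 0)
    (hBmm : ∀ κ u κ' u' x z (μ ν : Fin (d + 1)), tabs.vh₂S κ u κ' u' x z (Sum.inr μ) (Sum.inr ν) = 0) (j : ℕ)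
    (κ : Fin (d + 1)) (u : Fin (d + 1) → ℤ) (κ' : Fin (d + 1)) (u' t : Fin (d + 1) → ℤ) :
    ((fun κ u κ' u' => (cE₂ * (Lc : ℝ) ^ (2 * (d + 1))) • mmRead Lc (K3OfK (unitK (sfStep Lc j) (smStep d Lc j) (GcombSh (d := d) Lc j)) Lc (unitS (sfStep Lc j) (smStep d Lc j) (SpureCombOf tabs cE cVH cΛ j)) (unitM (sfStep Lc j) (smStep d Lc j) (tabs.M j)) (W2SymOfK (unitK (sfStep Lc j) (smStep d Lc j) (GcombSh (d := d) Lc j)) Lc (unitS (sfStep Lc j) (smStep d Lc j) (SpureCombOf tabs cE cVH cΛ j)) (unitM (sfStep Lc j) (smStep d Lc j) (tabs.M j)) 0 (unitM₂ (sfStep Lc j) (smStep d Lc j) (M2Of d Lc tabs.mixFF j))) κ u κ' u') + cB • tabs.vh₂S κ u κ' u')) κ (u + (Lc : ℤ) • t) κ' (u' + (Lc : ℤ) • t)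
      = shiftK (-((Lc : ℤ) • t)) (((fun κ u κ' u' => (cE₂ * (Lc : ℝ) ^ (2 * (d + 1))) • mmRead Lc (K3OfK (unitK (sfStep Lc j) (smStep d Lc j) (GcombSh (d := d) Lc j)) Lc (unitS (sfStep Lc j) (smStep d Lc j) (SpureCombOf tabs cE cVH cΛ j)) (unitM (sfStep Lc j) (smStep d Lc j) (tabs.M j)) (W2SymOfK (unitK (sfStep Lc j) (smStep d Lc j) (GcombSh (d := d) Lc j)) Lc (unitS (sfStep Lc j) (smStep d Lc j) (SpureCombOf tabs cE cVH cΛ j)) (unitM (sfStep Lc j) (smStep d Lc j) (tabs.M j)) 0 (unitM₂ (sfStep Lc j) (smStep d Lc j) (M2Of d Lc tabs.mixFF j))) κ u κ' u') + cB • tabs.vh₂S κ u κ' u')) κ u κ' u') := by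
  have e : ((fun κ u κ' u' => (cE₂ * (Lc : ℝ) ^ (2 * (d + 1))) • mmRead Lc (K3OfK (unitK (sfStep Lc j) (smStep d Lc j) (GcombSh (d := d) Lc j)) Lc (unitS (sfStep Lc j) (smStep d Lc j) (SpureCombOf tabs cE cVH cΛ j)) (unitM (sfStep Lc j) (smStep d Lc j) (tabs.M j)) (W2SymOfK (unitK (sfStep Lc j) (smStep d Lc j) (GcombSh (d := d) Lc j)) Lc (unitS (sfStep Lc j) (smStep d Lc j) (SpureCombOf tabs cE cVH cΛ j)) (unitM (sfStep Lc j) (smStep d Lc j) (tabs.M j)) 0 (unitM₂ (sfStep Lc j) (smStep d Lc j) (M2Of d Lc tabs.mixFF j))) κ u κ' u') + cB • tabs.vh₂S κ u κ' u'))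
      = unitS₂ (sfStep Lc (j + 1)) (smStep d Lc (j + 1)) (T2RecOf d Lc (GcombSh Lc) (SpureCombOf tabs cE cVH cΛ) tabs.M cE₂ cB Tc tabs.vh₂S tabs.mixFF (j + 1))
        - lin4 (cE₂ * (Lc : ℝ) ^ (2 * (d + 1))) (unitK (sfStep Lc j) (smStep d Lc j) (GcombSh (d := d) Lc j)) Lc (unitS₂ (sfStep Lc j) (smStep d Lc j) (T2RecOf d Lc (GcombSh Lc) (SpureCombOf tabs cE cVH cΛ) tabs.M cE₂ cB Tc tabs.vh₂S tabs.mixFF j)) := by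
    rw [succ_combChart tabs cE cVH cΛ cE₂ cB Tc hBff hBmm j, add_sub_cancel_left]
  rw [e]
  exact sub_translate_pi (w := (Lc : ℤ) • t) (v := -((Lc : ℤ) • t))
    (fun κ u κ' u' => unitS₂_T2RecOf_comb_translate tabs cE cVH cΛ cE₂ cB Tc (j + 1) κ u κ' u' t)
    (fun κ u κ' u' => lin4_translate (shiftK_unitK_GcombSh j) _
      (fun κ u κ' u' t => unitS₂_T2RecOf_comb_translate tabs cE cVH cΛ cE₂ cB Tc j κ u κ' u' t) κ u κ' u' ((Lc : ℤ) • t)) κ u κ' u'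

/-! ## §1 One comb-chart leg step on leg letters: the image law; the ruled class is preserved -/

/-- [folklore] **ONE COMB-CHART LEG STEP OF A LEG LETTER IS THE LEG LETTER OF THE ONE-STEP IMAGE**: for a bounded table `y` and every step `j`,
`legStepB (fun _ ↦ −(c·(Lc^{d+1})⁻¹)) G′♮ Lc j (rdiv ∘ y) = rdiv ∘ (lin4 c G′♮_j Lc y)` (W1's `rdiv_lin4_affine_GcombSh` with zero source) — the twin of MY (E)
`LegSourceRuledClass.legStepB_rdiv_eq`. -/
theorem legStepB_rdiv_eq_GcombSh (c : ℝ) (j : ℕ) {y : (Fin (d + 1) → (Fin (d + 1) → ℤ) → Fin (d + 1) → (Fin (d + 1) → ℤ) → MKer (d + 1) (Fib d))}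
    (hy : ∃ B : ℝ, ∀ κ u κ' u' x z a b, |y κ u κ' u' x z a b| ≤ B) :
    legStepB (fun _ : ℕ => -(c * ((Lc : ℝ) ^ (d + 1))⁻¹)) (fun m => unitK (sfStep Lc m) (smStep d Lc m) (GcombSh (d := d) Lc m)) Lc j (fun κ u κ' u' => rdiv (y κ u κ' u'))
      = fun κ u κ' u' => rdiv (lin4 c (unitK (sfStep Lc j) (smStep d Lc j) (GcombSh (d := d) Lc j)) Lc y κ u κ' u') := by
  obtain ⟨B, hBy⟩ := hy
  funext κ u κ' u'
  have h := rdiv_lin4_affine_GcombSh (d := d) (Lc := Lc) j c hBy (0 : (Fin (d + 1) → (Fin (d + 1) → ℤ) → Fin (d + 1) → (Fin (d + 1) → ℤ) → MKer (d + 1) (Fib d))) κ u κ' u'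
  rw [add_zero] at h
  simp only [Pi.zero_apply, rdiv_zero, add_zero] at h
  exact h.symm

/-- NOT IN PRINT; OUR BOOKKEEPING.  **ONE COMB-CHART LEG STEP KEEPS THE LEG LETTER OF A COVARIANT `LocStencil₂` TABLE IN THE RULED CLASS, AT EVERY STEP `j`**
(also at a step MISMATCHED with the table's level): `legStepB … j (rdiv ∘ y) = rdiv ∘ (𝒜^{G′}_j y)` and `𝒜^{G′}_j y` is jointly covariant (leaf-18's `lin4_translate` at W1's
`shiftK_unitK_GcombSh`) and `LocStencil₂` at a positive rate (`locStencil₂_lin4` at an2's `decays_GcombSh`), so MY generic `legLetter_mem_ruledClass` applies — the twin of MY (E)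
`LegSourceRuledClass.legStepB_rdiv_mem`. -/
theorem legStepB_rdiv_mem_GcombSh (c : ℝ) (j : ℕ) {y : (Fin (d + 1) → (Fin (d + 1) → ℤ) → Fin (d + 1) → (Fin (d + 1) → ℤ) → MKer (d + 1) (Fib d))}
    (hyc : ∀ κ u κ' u' t, y κ (u + (Lc : ℤ) • t) κ' (u' + (Lc : ℤ) • t) = shiftK (-((Lc : ℤ) • t)) (y κ u κ' u'))
    {C δ : ℝ} (hyl : LocStencil₂ y C δ) (hδ : 0 < δ) :
    (fun W : (Fin (d + 1) → (Fin (d + 1) → ℤ) → Fin (d + 1) → (Fin (d + 1) → ℤ) → MKer (d + 1) (Fib d)) =>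
      (∀ (κ : Fin (d + 1)) (u : Fin (d + 1) → ℤ) (κ' : Fin (d + 1)) (u' t : Fin (d + 1) → ℤ),
          W κ (u + (Lc : ℤ) • t) κ' (u' + (Lc : ℤ) • t) = shiftK (-((Lc : ℤ) • t)) (W κ u κ' u')) ∧
      (∀ (N' : ℕ) (κ κ' : Fin (d + 1)) (a b : Fib d), zmode N' W κ κ' a b = 0) ∧
      (∃ C' δ' : ℝ, 0 < δ' ∧ LocStencil₂ W C' δ'))
      (legStepB (fun _ : ℕ => -(c * ((Lc : ℝ) ^ (d + 1))⁻¹)) (fun m => unitK (sfStep Lc m) (smStep d Lc m) (GcombSh (d := d) Lc m)) Lc j (fun κ u κ' u' => rdiv (y κ u κ' u'))) := by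
  obtain ⟨δK, CK, hδK, hCK, hG⟩ := decays_GcombSh (d := d) Lc j
  have hA := locStencil₂_lin4 (decays_unitK (sf := sfStep Lc j) (sm := smStep d Lc j) hG) (by positivity) hδK (one_le_of_neZero Lc) c hyl hδ
  rw [legStepB_rdiv_eq_GcombSh c j (bdd₄_of_locStencil₂ hyl hδ.le)]
  exact legLetter_mem_ruledClass (fun κ u κ' u' t => lin4_translate (shiftK_unitK_GcombSh j) c hyc κ u κ' u' ((Lc : ℤ) • t)) hA (by positivity)

/-! ## §2 The comb-chart `ε`-member: its leg letters and their drifts are in the ruled class -/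

/-- [folklore] **THE `ε`-MEMBER OF THE COMB-CHART TOWER IS JOINTLY `Lc`-COVARIANT** (the OWNER's T5 `unitS₂_T2RecOf_comb_translate` ⨾ his `covariant_half`; the record's
border covariance `tabs.hBt` is inside T5) — the twin of MY (E) `LegRowsOnRuledClass.halfMember_translate`. -/
theorem halfMember_comb_translate (tabs : SymTables d Lc) (cE cVH cΛ cE₂ cB : ℝ) (Tc : Fin 4 → Fin 4 → Fin 4 → Fin 4 → ℝ) (ε : ℝ) (n : ℕ)
    (κ : Fin (d + 1)) (u : Fin (d + 1) → ℤ) (κ' : Fin (d + 1)) (u' t : Fin (d + 1) → ℤ) :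
    (((1 : ℝ) / 2) • (unitS₂ (sfStep Lc n) (smStep d Lc n) (T2RecOf d Lc (GcombSh Lc) (SpureCombOf tabs cE cVH cΛ) tabs.M cE₂ cB Tc tabs.vh₂S tabs.mixFF n) + ε • fun κ u κ' u' => sgnK (trK ((unitS₂ (sfStep Lc n) (smStep d Lc n) (T2RecOf d Lc (GcombSh Lc) (SpureCombOf tabs cE cVH cΛ) tabs.M cE₂ cB Tc tabs.vh₂S tabs.mixFF n)) κ u κ' u')))) κ (u + (Lc : ℤ) • t) κ' (u' + (Lc : ℤ) • t)
      = shiftK (-((Lc : ℤ) • t)) ((((1 : ℝ) / 2) • (unitS₂ (sfStep Lc n) (smStep d Lc n) (T2RecOf d Lc (GcombSh Lc) (SpureCombOf tabs cE cVH cΛ) tabs.M cE₂ cB Tc tabs.vh₂S tabs.mixFF n) + ε • fun κ u κ' u' => sgnK (trK ((unitS₂ (sfStep Lc n) (smStep d Lc n) (T2RecOf d Lc (GcombSh Lc) (SpureCombOf tabs cE cVH cΛ) tabs.M cE₂ cB Tc tabs.vh₂S tabs.mixFF n)) κ u κ' u')))) κ u κ' u') :=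
  covariant_half (fun κ u κ' u' t => unitS₂_T2RecOf_comb_translate tabs cE cVH cΛ cE₂ cB Tc n κ u κ' u' t) ε κ u κ' u' t

/-- NOT IN PRINT; OUR BOOKKEEPING.  **THE LEG LETTERS OF THE COMB-CHART `ε`-MEMBER ARE IN THE RULED CLASS AT EVERY LEVEL** (`|ε| ≤ 1`) — the twin of MY (E)
`LegRowsOnRuledClass.halfMember_legLetter_mem` (leaf-01's `locStencil₂_unitS₂_T2RecOf_comb` ⨾ the OWNER's `biLoc_half` ⨾ MY generic `legLetter_mem_ruledClass`). -/
theorem halfMember_comb_legLetter_mem (tabs : SymTables d Lc) (cE cVH cΛ cE₂ cB : ℝ) (Tc : Fin 4 → Fin 4 → Fin 4 → Fin 4 → ℝ) {ε : ℝ} (hε : |ε| ≤ 1) (n : ℕ) :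
    (fun W : (Fin (d + 1) → (Fin (d + 1) → ℤ) → Fin (d + 1) → (Fin (d + 1) → ℤ) → MKer (d + 1) (Fib d)) =>
      (∀ (κ : Fin (d + 1)) (u : Fin (d + 1) → ℤ) (κ' : Fin (d + 1)) (u' t : Fin (d + 1) → ℤ),
          W κ (u + (Lc : ℤ) • t) κ' (u' + (Lc : ℤ) • t) = shiftK (-((Lc : ℤ) • t)) (W κ u κ' u')) ∧
      (∀ (N' : ℕ) (κ κ' : Fin (d + 1)) (a b : Fib d), zmode N' W κ κ' a b = 0) ∧
      (∃ C' δ' : ℝ, 0 < δ' ∧ LocStencil₂ W C' δ')) (fun κ u κ' u' => rdiv ((((1 : ℝ) / 2) • (unitS₂ (sfStep Lc n) (smStep d Lc n) (T2RecOf d Lc (GcombSh Lc) (SpureCombOf tabs cE cVH cΛ) tabs.M cE₂ cB Tc tabs.vh₂S tabs.mixFF n) + ε • fun κ u κ' u' => sgnK (trK ((unitS₂ (sfStep Lc n) (smStep d Lc n) (T2RecOf d Lc (GcombSh Lc) (SpureCombOf tabs cE cVH cΛ) tabs.M cE₂ cB Tc tabs.vh₂S tabs.mixFF n)) κ u κ'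 u')))) κ u κ' u')) := by
  obtain ⟨Cn, δn, hδn, hn⟩ := locStencil₂_unitS₂_T2RecOf_comb tabs cE cVH cΛ cE₂ cB Tc n
  have hyn : LocStencil₂ (((1 : ℝ) / 2) • (unitS₂ (sfStep Lc n) (smStep d Lc n) (T2RecOf d Lc (GcombSh Lc) (SpureCombOf tabs cE cVH cΛ) tabs.M cE₂ cB Tc tabs.vh₂S tabs.mixFF n) + ε • fun κ u κ' u' => sgnK (trK ((unitS₂ (sfStep Lc n) (smStep d Lc n) (T2RecOf d Lc (GcombSh Lc) (SpureCombOf tabs cE cVH cΛ) tabs.M cE₂ cB Tc tabs.vh₂S tabs.mixFF n)) κ u κ' u')))) Cn δn := fun κ u κ' u' => biLoc_half (hn κ u κ' u') hε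
  exact legLetter_mem_ruledClass (halfMember_comb_translate tabs cE cVH cΛ cE₂ cB Tc ε n) hyn hδn

/-- NOT IN PRINT; OUR BOOKKEEPING.  **THE LEG DRIFTS OF THE COMB-CHART `ε`-MEMBER ARE IN THE RULED CLASS AT EVERY LEVEL** (`|ε| ≤ 1`; the twin of MY (E)
`LegRowsOnRuledClass.halfMember_legDrift_mem`): `y_{n+1} − y_n` is jointly covariant and
`LocStencil₂` at the smaller of the two rates, so MY generic `legLetter_mem_ruledClass` applies to it, and `rdiv ∘ (y_{n+1} − y_n) = rdiv ∘ y_{n+1} − rdiv ∘ y_n` (MY (E)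
`LegDriftRowsOfLegChain.rdiv_comp_sub`). -/
theorem halfMember_comb_legDrift_mem (tabs : SymTables d Lc) (cE cVH cΛ cE₂ cB : ℝ) (Tc : Fin 4 → Fin 4 → Fin 4 → Fin 4 → ℝ) {ε : ℝ} (hε : |ε| ≤ 1) (n : ℕ) :
    (fun W : (Fin (d + 1) → (Fin (d + 1) → ℤ) → Fin (d + 1) → (Fin (d + 1) → ℤ) → MKer (d + 1) (Fib d)) =>
      (∀ (κ : Fin (d + 1)) (u : Fin (d + 1) → ℤ) (κ' : Fin (d + 1)) (u' t : Fin (d + 1) → ℤ),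
          W κ (u + (Lc : ℤ) • t) κ' (u' + (Lc : ℤ) • t) = shiftK (-((Lc : ℤ) • t)) (W κ u κ' u')) ∧
      (∀ (N' : ℕ) (κ κ' : Fin (d + 1)) (a b : Fib d), zmode N' W κ κ' a b = 0) ∧
      (∃ C' δ' : ℝ, 0 < δ' ∧ LocStencil₂ W C' δ')) ((fun κ u κ' u' => rdiv ((((1 : ℝ) / 2) • (unitS₂ (sfStep Lc (n + 1)) (smStep d Lc (n + 1)) (T2RecOf d Lc (GcombSh Lc) (SpureCombOf tabs cE cVH cΛ) tabs.M cE₂ cB Tc tabs.vh₂S tabs.mixFF (n + 1)) + ε • fun κ u κ' u' => sgnK (trK ((unitS₂ (sfStep Lc (n + 1)) (smStep d Lc (n + 1)) (T2RecOf d Lc (GcombSh Lc) (SpureCombOf tabs cE cVH cΛ) tabs.M cE₂ cB Tc tabs.vh₂S tabs.mixFF (n + 1))) κ u κ' u')))) κ u κ' u'))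
      - fun κ u κ' u' => rdiv ((((1 : ℝ) / 2) • (unitS₂ (sfStep Lc n) (smStep d Lc n) (T2RecOf d Lc (GcombSh Lc) (SpureCombOf tabs cE cVH cΛ) tabs.M cE₂ cB Tc tabs.vh₂S tabs.mixFF n) + ε • fun κ u κ' u' => sgnK (trK ((unitS₂ (sfStep Lc n) (smStep d Lc n) (T2RecOf d Lc (GcombSh Lc) (SpureCombOf tabs cE cVH cΛ) tabs.M cE₂ cB Tc tabs.vh₂S tabs.mixFF n)) κ u κ' u')))) κ u κ' u')) := by
  obtain ⟨Cn, δn, hδn, hn⟩ := locStencil₂_unitS₂_T2RecOf_comb tabs cE cVH cΛ cE₂ cB Tc n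
  obtain ⟨Cm, δm, hδm, hm⟩ := locStencil₂_unitS₂_T2RecOf_comb tabs cE cVH cΛ cE₂ cB Tc (n + 1)
  have hyn : LocStencil₂ (((1 : ℝ) / 2) • (unitS₂ (sfStep Lc n) (smStep d Lc n) (T2RecOf d Lc (GcombSh Lc) (SpureCombOf tabs cE cVH cΛ) tabs.M cE₂ cB Tc tabs.vh₂S tabs.mixFF n) + ε • fun κ u κ' u' => sgnK (trK ((unitS₂ (sfStep Lc n) (smStep d Lc n) (T2RecOf d Lc (GcombSh Lc) (SpureCombOf tabs cE cVH cΛ) tabs.M cE₂ cB Tc tabs.vh₂S tabs.mixFF n)) κ u κ' u')))) Cn (min δn δm) := fun κ u κ' u' => biLoc_half ((hn.mono (min_le_left _ _)) κ u κ' u') hε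
  have hym : LocStencil₂ (((1 : ℝ) / 2) • (unitS₂ (sfStep Lc (n + 1)) (smStep d Lc (n + 1)) (T2RecOf d Lc (GcombSh Lc) (SpureCombOf tabs cE cVH cΛ) tabs.M cE₂ cB Tc tabs.vh₂S tabs.mixFF (n + 1)) + ε • fun κ u κ' u' => sgnK (trK ((unitS₂ (sfStep Lc (n + 1)) (smStep d Lc (n + 1)) (T2RecOf d Lc (GcombSh Lc) (SpureCombOf tabs cE cVH cΛ) tabs.M cE₂ cB Tc tabs.vh₂S tabs.mixFF (n + 1))) κ u κ' u')))) Cm (min δn δm) := fun κ u κ' u' => biLoc_half ((hm.mono (min_le_right _ _)) κ u κ' u') hε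
  have hdiff : LocStencil₂ ((((1 : ℝ) / 2) • (unitS₂ (sfStep Lc (n + 1)) (smStep d Lc (n + 1)) (T2RecOf d Lc (GcombSh Lc) (SpureCombOf tabs cE cVH cΛ) tabs.M cE₂ cB Tc tabs.vh₂S tabs.mixFF (n + 1)) + ε • fun κ u κ' u' => sgnK (trK ((unitS₂ (sfStep Lc (n + 1)) (smStep d Lc (n + 1)) (T2RecOf d Lc (GcombSh Lc) (SpureCombOf tabs cE cVH cΛ) tabs.M cE₂ cB Tc tabs.vh₂S tabs.mixFF (n + 1))) κ u κ' u'))))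
      - (((1 : ℝ) / 2) • (unitS₂ (sfStep Lc n) (smStep d Lc n) (T2RecOf d Lc (GcombSh Lc) (SpureCombOf tabs cE cVH cΛ) tabs.M cE₂ cB Tc tabs.vh₂S tabs.mixFF n) + ε • fun κ u κ' u' => sgnK (trK ((unitS₂ (sfStep Lc n) (smStep d Lc n) (T2RecOf d Lc (GcombSh Lc) (SpureCombOf tabs cE cVH cΛ) tabs.M cE₂ cB Tc tabs.vh₂S tabs.mixFF n)) κ u κ' u'))))) (Cm + Cn) (min δn δm) := locStencil₂_sub hym hyn
  have hcov : ∀ (κ : Fin (d + 1)) (u : Fin (d + 1) → ℤ) (κ' : Fin (d + 1)) (u' t : Fin (d + 1) → ℤ),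
      ((((1 : ℝ) / 2) • (unitS₂ (sfStep Lc (n + 1)) (smStep d Lc (n + 1)) (T2RecOf d Lc (GcombSh Lc) (SpureCombOf tabs cE cVH cΛ) tabs.M cE₂ cB Tc tabs.vh₂S tabs.mixFF (n + 1)) + ε • fun κ u κ' u' => sgnK (trK ((unitS₂ (sfStep Lc (n + 1)) (smStep d Lc (n + 1)) (T2RecOf d Lc (GcombSh Lc) (SpureCombOf tabs cE cVH cΛ) tabs.M cE₂ cB Tc tabs.vh₂S tabs.mixFF (n + 1))) κ u κ' u'))))
        - (((1 : ℝ) / 2) • (unitS₂ (sfStep Lc n) (smStep d Lc n) (T2RecOf d Lc (GcombSh Lc) (SpureCombOf tabs cE cVH cΛ) tabs.M cE₂ cB Tc tabs.vh₂S tabs.mixFF n) + ε • fun κ u κ' u' => sgnK (trK ((unitS₂ (sfStep Lc n) (smStep d Lc n) (T2RecOf d Lc (GcombSh Lc) (SpureCombOf tabs cE cVH cΛ) tabs.M cE₂ cB Tc tabs.vh₂S tabs.mixFF n)) κ u κ' u'))))) κ (u + (Lc : ℤ) • t) κ' (u' + (Lc : ℤ) • t)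
      = shiftK (-((Lc : ℤ) • t)) (((((1 : ℝ) / 2) • (unitS₂ (sfStep Lc (n + 1)) (smStep d Lc (n + 1)) (T2RecOf d Lc (GcombSh Lc) (SpureCombOf tabs cE cVH cΛ) tabs.M cE₂ cB Tc tabs.vh₂S tabs.mixFF (n + 1)) + ε • fun κ u κ' u' => sgnK (trK ((unitS₂ (sfStep Lc (n + 1)) (smStep d Lc (n + 1)) (T2RecOf d Lc (GcombSh Lc) (SpureCombOf tabs cE cVH cΛ) tabs.M cE₂ cB Tc tabs.vh₂S tabs.mixFF (n + 1))) κ u κ' u'))))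
        - (((1 : ℝ) / 2) • (unitS₂ (sfStep Lc n) (smStep d Lc n) (T2RecOf d Lc (GcombSh Lc) (SpureCombOf tabs cE cVH cΛ) tabs.M cE₂ cB Tc tabs.vh₂S tabs.mixFF n) + ε • fun κ u κ' u' => sgnK (trK ((unitS₂ (sfStep Lc n) (smStep d Lc n) (T2RecOf d Lc (GcombSh Lc) (SpureCombOf tabs cE cVH cΛ) tabs.M cE₂ cB Tc tabs.vh₂S tabs.mixFF n)) κ u κ' u'))))) κ u κ' u') := by
    intro κ u κ' u' t
    have e1 : ((((1 : ℝ) / 2) • (unitS₂ (sfStep Lc (n + 1)) (smStep d Lc (n + 1)) (T2RecOf d Lc (GcombSh Lc) (SpureCombOf tabs cE cVH cΛ) tabs.M cE₂ cB Tc tabs.vh₂S tabs.mixFF (n + 1)) + ε • fun κ u κ' u' => sgnK (trK ((unitS₂ (sfStep Lc (n + 1)) (smStep d Lc (n + 1)) (T2RecOf d Lc (GcombSh Lc) (SpureCombOf tabs cE cVH cΛ) tabs.M cE₂ cB Tc tabs.vh₂S tabs.mixFF (n + 1))) κ u κ' u'))))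
        - (((1 : ℝ) / 2) • (unitS₂ (sfStep Lc n) (smStep d Lc n) (T2RecOf d Lc (GcombSh Lc) (SpureCombOf tabs cE cVH cΛ) tabs.M cE₂ cB Tc tabs.vh₂S tabs.mixFF n) + ε • fun κ u κ' u' => sgnK (trK ((unitS₂ (sfStep Lc n) (smStep d Lc n) (T2RecOf d Lc (GcombSh Lc) (SpureCombOf tabs cE cVH cΛ) tabs.M cE₂ cB Tc tabs.vh₂S tabs.mixFF n)) κ u κ' u'))))) κ (u + (Lc : ℤ) • t) κ' (u' + (Lc : ℤ) • t)
      = (((1 : ℝ) / 2) • (unitS₂ (sfStep Lc (n + 1)) (smStep d Lc (n + 1)) (T2RecOf d Lc (GcombSh Lc) (SpureCombOf tabs cE cVH cΛ) tabs.M cE₂ cB Tc tabs.vh₂S tabs.mixFF (n + 1)) + ε • fun κ u κ' u' => sgnK (trK ((unitS₂ (sfStep Lc (n + 1)) (smStep d Lc (n + 1)) (T2RecOf d Lc (GcombSh Lc) (SpureCombOf tabs cE cVH cΛ) tabs.M cE₂ cB Tc tabs.vh₂S tabs.mixFF (n + 1))) κ u κ' u')))) κ (u + (Lc : ℤ) •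 t) κ' (u' + (Lc : ℤ) • t)
        - (((1 : ℝ) / 2) • (unitS₂ (sfStep Lc n) (smStep d Lc n) (T2RecOf d Lc (GcombSh Lc) (SpureCombOf tabs cE cVH cΛ) tabs.M cE₂ cB Tc tabs.vh₂S tabs.mixFF n) + ε • fun κ u κ' u' => sgnK (trK ((unitS₂ (sfStep Lc n) (smStep d Lc n) (T2RecOf d Lc (GcombSh Lc) (SpureCombOf tabs cE cVH cΛ) tabs.M cE₂ cB Tc tabs.vh₂S tabs.mixFF n)) κ u κ' u')))) κ (u + (Lc : ℤ) • t) κ' (u' + (Lc : ℤ) • t) := rfl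
    have e2 : ((((1 : ℝ) / 2) • (unitS₂ (sfStep Lc (n + 1)) (smStep d Lc (n + 1)) (T2RecOf d Lc (GcombSh Lc) (SpureCombOf tabs cE cVH cΛ) tabs.M cE₂ cB Tc tabs.vh₂S tabs.mixFF (n + 1)) + ε • fun κ u κ' u' => sgnK (trK ((unitS₂ (sfStep Lc (n + 1)) (smStep d Lc (n + 1)) (T2RecOf d Lc (GcombSh Lc) (SpureCombOf tabs cE cVH cΛ) tabs.M cE₂ cB Tc tabs.vh₂S tabs.mixFF (n + 1))) κ u κ' u'))))
        - (((1 : ℝ) / 2) • (unitS₂ (sfStep Lc n) (smStep d Lc n) (T2RecOf d Lc (GcombSh Lc) (SpureCombOf tabs cE cVH cΛ) tabs.M cE₂ cB Tc tabs.vh₂S tabs.mixFF n) + ε • fun κ u κ' u' => sgnK (trK ((unitS₂ (sfStep Lc n) (smStep d Lc n) (T2RecOf d Lc (GcombSh Lc) (SpureCombOf tabs cE cVH cΛ) tabs.M cE₂ cB Tc tabs.vh₂S tabs.mixFF n)) κ u κ' u'))))) κ u κ' u'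
      = (((1 : ℝ) / 2) • (unitS₂ (sfStep Lc (n + 1)) (smStep d Lc (n + 1)) (T2RecOf d Lc (GcombSh Lc) (SpureCombOf tabs cE cVH cΛ) tabs.M cE₂ cB Tc tabs.vh₂S tabs.mixFF (n + 1)) + ε • fun κ u κ' u' => sgnK (trK ((unitS₂ (sfStep Lc (n + 1)) (smStep d Lc (n + 1)) (T2RecOf d Lc (GcombSh Lc) (SpureCombOf tabs cE cVH cΛ) tabs.M cE₂ cB Tc tabs.vh₂S tabs.mixFF (n + 1))) κ u κ' u')))) κ u κ' u'
        - (((1 : ℝ) / 2) • (unitS₂ (sfStep Lc n) (smStep d Lc n) (T2RecOf d Lc (GcombSh Lc) (SpureCombOf tabs cE cVH cΛ) tabs.M cE₂ cB Tc tabs.vh₂S tabs.mixFF n) + ε • fun κ u κ' u' => sgnK (trK ((unitS₂ (sfStep Lc n) (smStep d Lc n) (T2RecOf d Lc (GcombSh Lc) (SpureCombOf tabs cE cVH cΛ) tabs.M cE₂ cB Tc tabs.vh₂S tabs.mixFF n)) κ u κ' u')))) κ u κ' u' := rfl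
    rw [e1, e2, halfMember_comb_translate tabs cE cVH cΛ cE₂ cB Tc ε (n + 1) κ u κ' u' t,
      halfMember_comb_translate tabs cE cVH cΛ cE₂ cB Tc ε n κ u κ' u' t]
    rfl
  have h := legLetter_mem_ruledClass hcov hdiff (lt_min hδn hδm)
  rw [rdiv_comp_sub] at h
  exact h

/-! ## §3 The comb-chart `ε`-member's sources: covariant, `LocStencil₂`, leg letters in the ruled class -/

/-- [folklore] **THE COMB-CHART `ε`-MEMBER's SOURCE `F′^ε_l = ½•(b̃′_l + ε•P b̃′_l)` IS JOINTLY `Lc`-COVARIANT** (§0's `source_combChart_translate` ⨾ the OWNER's `covariant_half`;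
off-diagonal border `hBff hBmm` displayed) — the twin of MY (E) `LegSourceRuledClass.halfSource_translate`. -/
theorem halfSource_comb_translate (tabs : SymTables d Lc) (cE cVH cΛ cE₂ cB : ℝ) (Tc : Fin 4 → Fin 4 → Fin 4 → Fin 4 → ℝ)
    (hBff : ∀ κ u κ' u' x z (α β : Fin (d + 1)), tabs.vh₂S κ u κ' u' x z (Sum.inl α) (Sum.inl β) = 0)
    (hBmm : ∀ κ u κ' u' x z (μ ν : Fin (d + 1)), tabs.vh₂S κ u κ' u' x z (Sum.inr μ) (Sum.inr ν) = 0) (ε : ℝ) (l : ℕ)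
    (κ : Fin (d + 1)) (u : Fin (d + 1) → ℤ) (κ' : Fin (d + 1)) (u' t : Fin (d + 1) → ℤ) :
    (((1 : ℝ) / 2) • ((fun κ u κ' u' => (cE₂ * (Lc : ℝ) ^ (2 * (d + 1))) • mmRead Lc (K3OfK (unitK (sfStep Lc l) (smStep d Lc l) (GcombSh (d := d) Lc l)) Lc (unitS (sfStep Lc l) (smStep d Lc l) (SpureCombOf tabs cE cVH cΛ l)) (unitM (sfStep Lc l) (smStep d Lc l) (tabs.M l)) (W2SymOfK (unitK (sfStep Lc l) (smStep d Lc l) (GcombSh (d := d) Lc l)) Lc (unitS (sfStep Lc l) (smStep d Lc l) (SpureCombOf tabs cE cVH cΛ l)) (unitM (sfStep Lc l) (smStep d Lc l) (tabs.M l)) 0 (unitM₂ (sfStep Lc l) (smStep d Lc l) (M2Of d Lc tabs.mixFF l))) κ u κ' u') + cB • tabs.vh₂S κ u κ' u') + ε • fun κ u κ' u' => sgnK (trK (((fun κ u κ' u' => (cE₂ * (Lc : ℝ) ^ (2 * (d + 1))) • mmRead Lc (K3OfK (unitK (sfStep Lc l) (smStep d Lc l) (GcombSh (d := d) Lc l))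 Lc (unitS (sfStep Lc l) (smStep d Lc l) (SpureCombOf tabs cE cVH cΛ l)) (unitM (sfStep Lc l) (smStep d Lc l) (tabs.M l)) (W2SymOfK (unitK (sfStep Lc l) (smStep d Lc l) (GcombSh (d := d) Lc l)) Lc (unitS (sfStep Lc l) (smStep d Lc l) (SpureCombOf tabs cE cVH cΛ l)) (unitM (sfStep Lc l) (smStep d Lc l) (tabs.M l)) 0 (unitM₂ (sfStep Lc l) (smStep d Lc l) (M2Of d Lc tabs.mixFF l))) κ u κ' u') + cB • tabs.vh₂S κ u κ' u')) κ u κ' u')))) κ (u + (Lc : ℤ) • t) κ' (u' + (Lc : ℤ) • t)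
      = shiftK (-((Lc : ℤ) • t)) ((((1 : ℝ) / 2) • ((fun κ u κ' u' => (cE₂ * (Lc : ℝ) ^ (2 * (d + 1))) • mmRead Lc (K3OfK (unitK (sfStep Lc l) (smStep d Lc l) (GcombSh (d := d) Lc l)) Lc (unitS (sfStep Lc l) (smStep d Lc l) (SpureCombOf tabs cE cVH cΛ l)) (unitM (sfStep Lc l) (smStep d Lc l) (tabs.M l)) (W2SymOfK (unitK (sfStep Lc l) (smStep d Lc l) (GcombSh (d := d) Lc l)) Lc (unitS (sfStep Lc l) (smStep d Lc l) (SpureCombOf tabs cE cVH cΛ l)) (unitM (sfStep Lc l) (smStep d Lc l) (tabs.M l)) 0 (unitM₂ (sfStep Lc l) (smStep d Lc l) (M2Of d Lc tabs.mixFF l))) κ u κ' u') + cB • tabs.vh₂S κ u κ' u') + ε • fun κ u κ' u' => sgnK (trK (((fun κ u κ' u' => (cE₂ * (Lc : ℝ) ^ (2 * (d + 1))) • mmRead Lc (K3OfK (unitK (sfStep Lc l) (smStep d Lc l) (GcombSh (d := d) Lc l)) Lc (unitS (sfStep Lc l) (smStep d Lc l) (SpureCombOf tabs cE cVH cΛ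 l)) (unitM (sfStep Lc l) (smStep d Lc l) (tabs.M l)) (W2SymOfK (unitK (sfStep Lc l) (smStep d Lc l) (GcombSh (d := d) Lc l)) Lc (unitS (sfStep Lc l) (smStep d Lc l) (SpureCombOf tabs cE cVH cΛ l)) (unitM (sfStep Lc l) (smStep d Lc l) (tabs.M l)) 0 (unitM₂ (sfStep Lc l) (smStep d Lc l) (M2Of d Lc tabs.mixFF l))) κ u κ' u') + cB • tabs.vh₂S κ u κ' u')) κ u κ' u')))) κ u κ' u') :=
  covariant_half (N := Lc) (T := (fun κ u κ' u' => (cE₂ * (Lc : ℝ) ^ (2 * (d + 1))) • mmRead Lc (K3OfK (unitK (sfStep Lc l) (smStep d Lc l) (GcombSh (d := d) Lc l)) Lc (unitS (sfStep Lc l) (smStep d Lc l) (SpureCombOf tabs cE cVH cΛ l)) (unitM (sfStep Lc l) (smStep d Lc l) (tabs.M l)) (W2SymOfK (unitK (sfStep Lc l) (smStep d Lc l) (GcombSh (d := d) Lc l)) Lc (unitS (sfStep Lc l) (smStep d Lc l) (SpureCombOf tabs cE cVH cΛ l)) (unitM (sfStep Lc l) (smStep d Lc l) (tabs.M l)) 0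 (unitM₂ (sfStep Lc l) (smStep d Lc l) (M2Of d Lc tabs.mixFF l))) κ u κ' u') + cB • tabs.vh₂S κ u κ' u'))
    (fun κ u κ' u' t => source_combChart_translate tabs cE cVH cΛ cE₂ cB Tc hBff hBmm l κ u κ' u' t) ε κ u κ' u' t

/-- [folklore] **THE COMB-CHART DRESSED SOURCE `b̃′_l` IS `LocStencil₂` AT SOME POSITIVE RATE** (level by level: `b̃′_l = T̃′♮_{l+1} − 𝒜^{G′}_l T̃′♮_l` by §0's (F1) step; both terms by
leaf-01's `locStencil₂_unitS₂_T2RecOf_comb` and leaf-18's `locStencil₂_lin4`) — the twin of MY (E) `LegSourceRuledClass.exists_locStencil₂_source_comb`. -/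
theorem exists_locStencil₂_source_combChart (tabs : SymTables d Lc) (cE cVH cΛ cE₂ cB : ℝ) (Tc : Fin 4 → Fin 4 → Fin 4 → Fin 4 → ℝ)
    (hBff : ∀ κ u κ' u' x z (α β : Fin (d + 1)), tabs.vh₂S κ u κ' u' x z (Sum.inl α) (Sum.inl β) = 0)
    (hBmm : ∀ κ u κ' u' x z (μ ν : Fin (d + 1)), tabs.vh₂S κ u κ' u' x z (Sum.inr μ) (Sum.inr ν) = 0) (l : ℕ) :
    ∃ C δ : ℝ, 0 < δ ∧ LocStencil₂ (fun κ u κ' u' => (cE₂ * (Lc : ℝ) ^ (2 * (d + 1))) • mmRead Lc (K3OfK (unitK (sfStep Lc l) (smStep d Lc l) (GcombSh (d := d) Lc l)) Lc (unitS (sfStep Lc l) (smStep d Lc l) (SpureCombOf tabs cE cVH cΛ l)) (unitM (sfStep Lc l) (smStep d Lc l) (tabs.M l)) (W2SymOfK (unitK (sfStep Lc l) (smStep d Lc l) (GcombSh (d := d) Lc l)) Lc (unitS (sfStep Lc l) (smStep d Lc l) (SpureCombOf tabs cE cVH cΛ l)) (unitM (sfStep Lc l) (smStep d Lc l) (tabs.M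 l)) 0 (unitM₂ (sfStep Lc l) (smStep d Lc l) (M2Of d Lc tabs.mixFF l))) κ u κ' u') + cB • tabs.vh₂S κ u κ' u') C δ := by
  obtain ⟨CT, δT, hδT, hT⟩ := locStencil₂_unitS₂_T2RecOf_comb tabs cE cVH cΛ cE₂ cB Tc l
  obtain ⟨CT', δT', hδT', hT'⟩ := locStencil₂_unitS₂_T2RecOf_comb tabs cE cVH cΛ cE₂ cB Tc (l + 1)
  obtain ⟨δK, CK, hδK, hCK, hG⟩ := decays_GcombSh (d := d) Lc l
  have hA := locStencil₂_lin4 (decays_unitK (sf := sfStep Lc l) (sm := smStep d Lc l) hG) (by positivity) hδK (one_le_of_neZero Lc)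
    (cE₂ * (Lc : ℝ) ^ (2 * (d + 1))) hT hδT
  have hrate : 0 < min δT' (min δK δT / 128) := by positivity
  have hsub := locStencil₂_sub (hT'.mono (min_le_left _ _)) (hA.mono (min_le_right _ _))
  rw [succ_combChart tabs cE cVH cΛ cE₂ cB Tc hBff hBmm l, add_sub_cancel_left] at hsub
  exact ⟨_, _, hrate, hsub⟩

/-- [folklore] **THE COMB-CHART `ε`-MEMBER's SOURCE IS `LocStencil₂` AT SOME POSITIVE RATE** (`|ε| ≤ 1`; the OWNER's `locStencil₂_half`). -/
theorem exists_locStencil₂_halfSource_comb (tabs : SymTables d Lc) (cE cVH cΛ cE₂ cB : ℝ) (Tc : Fin 4 → Fin 4 → Fin 4 → Fin 4 → ℝ)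
    (hBff : ∀ κ u κ' u' x z (α β : Fin (d + 1)), tabs.vh₂S κ u κ' u' x z (Sum.inl α) (Sum.inl β) = 0)
    (hBmm : ∀ κ u κ' u' x z (μ ν : Fin (d + 1)), tabs.vh₂S κ u κ' u' x z (Sum.inr μ) (Sum.inr ν) = 0) {ε : ℝ} (hε : |ε| ≤ 1) (l : ℕ) :
    ∃ C δ : ℝ, 0 < δ ∧ LocStencil₂ (((1 : ℝ) / 2) • ((fun κ u κ' u' => (cE₂ * (Lc : ℝ) ^ (2 * (d + 1))) • mmRead Lc (K3OfK (unitK (sfStep Lc l) (smStep d Lc l) (GcombSh (d := d) Lc l)) Lc (unitS (sfStep Lc l) (smStep d Lc l) (SpureCombOf tabs cE cVH cΛ l)) (unitM (sfStep Lc l) (smStep d Lc l) (tabs.M l)) (W2SymOfK (unitK (sfStep Lc l) (smStep d Lc l) (GcombSh (d := d) Lc l)) Lc (unitS (sfStep Lc l) (smStep d Lc l) (SpureCombOf tabs cE cVH cΛ l)) (unitM (sfStep Lc l) (smStep d Lc l) (tabs.M l)) 0 (unitM₂ (sfStep Lc l) (smStep d Lc l) (M2Of d Lc tabs.mixFF l)))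 κ u κ' u') + cB • tabs.vh₂S κ u κ' u') + ε • fun κ u κ' u' => sgnK (trK (((fun κ u κ' u' => (cE₂ * (Lc : ℝ) ^ (2 * (d + 1))) • mmRead Lc (K3OfK (unitK (sfStep Lc l) (smStep d Lc l) (GcombSh (d := d) Lc l)) Lc (unitS (sfStep Lc l) (smStep d Lc l) (SpureCombOf tabs cE cVH cΛ l)) (unitM (sfStep Lc l) (smStep d Lc l) (tabs.M l)) (W2SymOfK (unitK (sfStep Lc l) (smStep d Lc l) (GcombSh (d := d) Lc l)) Lc (unitS (sfStep Lc l) (smStep d Lc l) (SpureCombOf tabs cE cVH cΛ l)) (unitM (sfStep Lc l) (smStep d Lc l) (tabs.M l)) 0 (unitM₂ (sfStep Lc l) (smStep d Lc l) (M2Of d Lc tabs.mixFF l))) κ u κ' u') + cB • tabs.vh₂S κ u κ' u')) κ u κ' u')))) C δ := by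
  obtain ⟨C, δ, hδ, h⟩ := exists_locStencil₂_source_combChart tabs cE cVH cΛ cE₂ cB Tc hBff hBmm l
  exact ⟨C, δ, hδ, fun κ u κ' u' => (locStencil₂_half h hε) κ u κ' u'⟩

/-- NOT IN PRINT; OUR BOOKKEEPING.  **(HSP) AT (III′): THE SOURCE LEG LETTERS `rdiv ∘ F′^ε_l` OF THE COMB-CHART `ε`-MEMBER ARE IN THE RULED CLASS AT EVERY LEVEL** (`|ε| ≤ 1`;
off-diagonal border displayed): `halfSource_comb_translate` ⨾ `exists_locStencil₂_halfSource_comb` ⨾ MY generic `legLetter_mem_ruledClass` — the twin of MY (E)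
`LegSourceRuledClass.halfSource_legLetter_mem`. -/
theorem halfSource_comb_legLetter_mem (tabs : SymTables d Lc) (cE cVH cΛ cE₂ cB : ℝ) (Tc : Fin 4 → Fin 4 → Fin 4 → Fin 4 → ℝ)
    (hBff : ∀ κ u κ' u' x z (α β : Fin (d + 1)), tabs.vh₂S κ u κ' u' x z (Sum.inl α) (Sum.inl β) = 0)
    (hBmm : ∀ κ u κ' u' x z (μ ν : Fin (d + 1)), tabs.vh₂S κ u κ' u' x z (Sum.inr μ) (Sum.inr ν) = 0) {ε : ℝ} (hε : |ε| ≤ 1) (l : ℕ) :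
    (fun W : (Fin (d + 1) → (Fin (d + 1) → ℤ) → Fin (d + 1) → (Fin (d + 1) → ℤ) → MKer (d + 1) (Fib d)) =>
      (∀ (κ : Fin (d + 1)) (u : Fin (d + 1) → ℤ) (κ' : Fin (d + 1)) (u' t : Fin (d + 1) → ℤ),
          W κ (u + (Lc : ℤ) • t) κ' (u' + (Lc : ℤ) • t) = shiftK (-((Lc : ℤ) • t)) (W κ u κ' u')) ∧
      (∀ (N' : ℕ) (κ κ' : Fin (d + 1)) (a b : Fib d), zmode N' W κ κ' a b = 0) ∧
      (∃ C' δ' : ℝ, 0 < δ' ∧ LocStencil₂ W C' δ'))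
      (fun κ u κ' u' => rdiv ((((1 : ℝ) / 2) • ((fun κ u κ' u' => (cE₂ * (Lc : ℝ) ^ (2 * (d + 1))) • mmRead Lc (K3OfK (unitK (sfStep Lc l) (smStep d Lc l) (GcombSh (d := d) Lc l)) Lc (unitS (sfStep Lc l) (smStep d Lc l) (SpureCombOf tabs cE cVH cΛ l)) (unitM (sfStep Lc l) (smStep d Lc l) (tabs.M l)) (W2SymOfK (unitK (sfStep Lc l) (smStep d Lc l) (GcombSh (d := d) Lc l)) Lc (unitS (sfStep Lc l) (smStep d Lc l) (SpureCombOf tabs cE cVH cΛ l)) (unitM (sfStep Lc l) (smStep d Lc l) (tabs.M l)) 0 (unitM₂ (sfStep Lc l) (smStep d Lc l) (M2Of d Lc tabs.mixFF l))) κ u κ' u') + cB • tabs.vh₂S κ u κ' u') + ε • fun κ u κ' u' => sgnK (trK (((fun κ u κ' u' => (cE₂ * (Lc : ℝ) ^ (2 * (d + 1))) • mmRead Lc (K3OfK (unitK (sfStep Lc l) (smStep d Lc l) (GcombSh (d := d) Lc l)) Lc (unitS (sfStep Lc l) (smStep d Lc l) (SpureCombOf tabs cE cVH cΛ l)) (unitM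 (sfStep Lc l) (smStep d Lc l) (tabs.M l)) (W2SymOfK (unitK (sfStep Lc l) (smStep d Lc l) (GcombSh (d := d) Lc l)) Lc (unitS (sfStep Lc l) (smStep d Lc l) (SpureCombOf tabs cE cVH cΛ l)) (unitM (sfStep Lc l) (smStep d Lc l) (tabs.M l)) 0 (unitM₂ (sfStep Lc l) (smStep d Lc l) (M2Of d Lc tabs.mixFF l))) κ u κ' u') + cB • tabs.vh₂S κ u κ' u')) κ u κ' u')))) κ u κ' u')) := by
  obtain ⟨C, δ, hδ, h⟩ := exists_locStencil₂_halfSource_comb tabs cE cVH cΛ cE₂ cB Tc hBff hBmm hε l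
  exact legLetter_mem_ruledClass (halfSource_comb_translate tabs cE cVH cΛ cE₂ cB Tc hBff hBmm ε l) h hδ

/-! ## §4 The drift socket's difference sources at the comb-chart data are in the ruled class -/

/-- NOT IN PRINT; OUR BOOKKEEPING.  **W1's `hSP` AT (III′): THE DIFFERENCE SOURCE OF THE DRIFT SOCKET IS IN THE RULED CLASS AT EVERY LEVEL** (`|ε| ≤ 1`; the twin of MY (E)
`LegSourceRuledClass.halfDiffSource_mem`): `(legStepB … (l+1) − legStepB … l)(rdiv ∘ y_l) + (rdiv ∘ F′^ε_{l+1} − rdiv ∘ F′^ε_l) ∈ 𝒫` — `legStepB_rdiv_mem_GcombSh` at the steps `l+1` and `l` on the member `y_l`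
(covariant by `halfMember_comb_translate`, `LocStencil₂` by `locStencil₂_unitS₂_T2RecOf_comb` ⨾ `locStencil₂_half`), `halfSource_comb_legLetter_mem` at `l+1` and `l`, and
MY generic closure rows `ruledClass_sub ∕ ruledClass_add`. -/
theorem halfDiffSource_comb_mem (tabs : SymTables d Lc) (cE cVH cΛ cE₂ cB : ℝ) (Tc : Fin 4 → Fin 4 → Fin 4 → Fin 4 → ℝ)
    (hBff : ∀ κ u κ' u' x z (α β : Fin (d + 1)), tabs.vh₂S κ u κ' u' x z (Sum.inl α) (Sum.inl β) = 0)
    (hBmm : ∀ κ u κ' u' x z (μ ν : Fin (d + 1)), tabs.vh₂S κ u κ' u' x z (Sum.inr μ) (Sum.inr ν) = 0) {ε : ℝ} (hε : |ε| ≤ 1) (l : ℕ) :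
    (fun W : (Fin (d + 1) → (Fin (d + 1) → ℤ) → Fin (d + 1) → (Fin (d + 1) → ℤ) → MKer (d + 1) (Fib d)) =>
      (∀ (κ : Fin (d + 1)) (u : Fin (d + 1) → ℤ) (κ' : Fin (d + 1)) (u' t : Fin (d + 1) → ℤ),
          W κ (u + (Lc : ℤ) • t) κ' (u' + (Lc : ℤ) • t) = shiftK (-((Lc : ℤ) • t)) (W κ u κ' u')) ∧
      (∀ (N' : ℕ) (κ κ' : Fin (d + 1)) (a b : Fib d), zmode N' W κ κ' a b = 0) ∧
      (∃ C' δ' : ℝ, 0 < δ' ∧ LocStencil₂ W C' δ'))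
      ((legStepB (fun _ : ℕ => -((cE₂ * (Lc : ℝ) ^ (2 * (d + 1))) * ((Lc : ℝ) ^ (d + 1))⁻¹)) (fun m => unitK (sfStep Lc m) (smStep d Lc m) (GcombSh (d := d) Lc m)) Lc (l + 1) (fun κ u κ' u' => rdiv ((((1 : ℝ) / 2) • (unitS₂ (sfStep Lc l) (smStep d Lc l) (T2RecOf d Lc (GcombSh Lc) (SpureCombOf tabs cE cVH cΛ) tabs.M cE₂ cB Tc tabs.vh₂S tabs.mixFF l) + ε • fun κ u κ' u' => sgnK (trK ((unitS₂ (sfStep Lc l) (smStep d Lc l) (T2RecOf d Lc (GcombSh Lc) (SpureCombOf tabs cE cVH cΛ) tabs.M cE₂ cB Tc tabs.vh₂S tabs.mixFF l)) κ u κ' u')))) κ u κ' u'))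
          - legStepB (fun _ : ℕ => -((cE₂ * (Lc : ℝ) ^ (2 * (d + 1))) * ((Lc : ℝ) ^ (d + 1))⁻¹)) (fun m => unitK (sfStep Lc m) (smStep d Lc m) (GcombSh (d := d) Lc m)) Lc l (fun κ u κ' u' => rdiv ((((1 : ℝ) / 2) • (unitS₂ (sfStep Lc l) (smStep d Lc l) (T2RecOf d Lc (GcombSh Lc) (SpureCombOf tabs cE cVH cΛ) tabs.M cE₂ cB Tc tabs.vh₂S tabs.mixFF l) + ε • fun κ u κ' u' => sgnK (trK ((unitS₂ (sfStep Lc l) (smStep d Lc l) (T2RecOf d Lc (GcombSh Lc) (SpureCombOf tabs cE cVH cΛ) tabs.M cE₂ cB Tc tabs.vh₂S tabs.mixFF l)) κ u κ' u')))) κ u κ' u')))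
        + ((fun κ u κ' u' => rdiv ((((1 : ℝ) / 2) • ((fun κ u κ' u' => (cE₂ * (Lc : ℝ) ^ (2 * (d + 1))) • mmRead Lc (K3OfK (unitK (sfStep Lc (l + 1)) (smStep d Lc (l + 1)) (GcombSh (d := d) Lc (l + 1))) Lc (unitS (sfStep Lc (l + 1)) (smStep d Lc (l + 1)) (SpureCombOf tabs cE cVH cΛ (l + 1))) (unitM (sfStep Lc (l + 1)) (smStep d Lc (l + 1)) (tabs.M (l + 1))) (W2SymOfK (unitK (sfStep Lc (l + 1)) (smStep d Lc (l + 1)) (GcombSh (d := d) Lc (l + 1))) Lc (unitS (sfStep Lc (l + 1)) (smStep d Lc (l + 1)) (SpureCombOf tabs cE cVH cΛ (l + 1))) (unitM (sfStep Lc (l + 1)) (smStep d Lc (l + 1)) (tabs.M (l + 1))) 0 (unitM₂ (sfStep Lc (l + 1)) (smStep d Lc (l + 1)) (M2Of d Lc tabs.mixFF (l + 1)))) κ u κ' u') + cB • tabs.vh₂S κ u κ' u') + ε • fun κ u κ' u' => sgnK (trK (((fun κ u κ' u' => (cE₂ * (Lc : ℝ) ^ (2 * (d + 1))) • mmRead Lc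 (K3OfK (unitK (sfStep Lc (l + 1)) (smStep d Lc (l + 1)) (GcombSh (d := d) Lc (l + 1))) Lc (unitS (sfStep Lc (l + 1)) (smStep d Lc (l + 1)) (SpureCombOf tabs cE cVH cΛ (l + 1))) (unitM (sfStep Lc (l + 1)) (smStep d Lc (l + 1)) (tabs.M (l + 1))) (W2SymOfK (unitK (sfStep Lc (l + 1)) (smStep d Lc (l + 1)) (GcombSh (d := d) Lc (l + 1))) Lc (unitS (sfStep Lc (l + 1)) (smStep d Lc (l + 1)) (SpureCombOf tabs cE cVH cΛ (l + 1))) (unitM (sfStep Lc (l + 1)) (smStep d Lc (l + 1)) (tabs.M (l + 1))) 0 (unitM₂ (sfStep Lc (l + 1)) (smStep d Lc (l + 1)) (M2Of d Lc tabs.mixFF (l + 1)))) κ u κ' u') + cB • tabs.vh₂S κ u κ' u')) κ u κ' u')))) κ u κ' u')) - fun κ u κ' u' => rdiv ((((1 : ℝ) / 2) • ((fun κ u κ' u' => (cE₂ * (Lc : ℝ) ^ (2 * (d + 1))) • mmRead Lc (K3OfK (unitK (sfStep Lc l) (smStep d Lc l) (GcombSh (d := d) Lc l)) Lc (unitS (sfStep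 Lc l) (smStep d Lc l) (SpureCombOf tabs cE cVH cΛ l)) (unitM (sfStep Lc l) (smStep d Lc l) (tabs.M l)) (W2SymOfK (unitK (sfStep Lc l) (smStep d Lc l) (GcombSh (d := d) Lc l)) Lc (unitS (sfStep Lc l) (smStep d Lc l) (SpureCombOf tabs cE cVH cΛ l)) (unitM (sfStep Lc l) (smStep d Lc l) (tabs.M l)) 0 (unitM₂ (sfStep Lc l) (smStep d Lc l) (M2Of d Lc tabs.mixFF l))) κ u κ' u') + cB • tabs.vh₂S κ u κ' u') + ε • fun κ u κ' u' => sgnK (trK (((fun κ u κ' u' => (cE₂ * (Lc : ℝ) ^ (2 * (d + 1))) • mmRead Lc (K3OfK (unitK (sfStep Lc l) (smStep d Lc l) (GcombSh (d := d) Lc l)) Lc (unitS (sfStep Lc l) (smStep d Lc l) (SpureCombOf tabs cE cVH cΛ l)) (unitM (sfStep Lc l) (smStep d Lc l) (tabs.M l)) (W2SymOfK (unitK (sfStep Lc l) (smStep d Lc l) (GcombSh (d := d) Lc l)) Lc (unitS (sfStep Lc l) (smStep d Lc l) (SpureCombOf tabs cE cVH cΛ l)) (unitM (sfStep Lc l)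 (smStep d Lc l) (tabs.M l)) 0 (unitM₂ (sfStep Lc l) (smStep d Lc l) (M2Of d Lc tabs.mixFF l))) κ u κ' u') + cB • tabs.vh₂S κ u κ' u')) κ u κ' u')))) κ u κ' u'))) := by
  obtain ⟨Cn, δn, hδn, hn⟩ := locStencil₂_unitS₂_T2RecOf_comb tabs cE cVH cΛ cE₂ cB Tc l
  have hyl : LocStencil₂ (((1 : ℝ) / 2) • (unitS₂ (sfStep Lc l) (smStep d Lc l) (T2RecOf d Lc (GcombSh Lc) (SpureCombOf tabs cE cVH cΛ) tabs.M cE₂ cB Tc tabs.vh₂S tabs.mixFF l) + ε • fun κ u κ' u' => sgnK (trK ((unitS₂ (sfStep Lc l) (smStep d Lc l) (T2RecOf d Lc (GcombSh Lc) (SpureCombOf tabs cE cVH cΛ) tabs.M cE₂ cB Tc tabs.vh₂S tabs.mixFF l)) κ u κ' u')))) Cn δn := fun κ u κ' u' => (locStencil₂_half hn hε) κ u κ' u'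
  have hyc := halfMember_comb_translate tabs cE cVH cΛ cE₂ cB Tc ε l
  exact ruledClass_add
    (ruledClass_sub (legStepB_rdiv_mem_GcombSh (cE₂ * (Lc : ℝ) ^ (2 * (d + 1))) (l + 1) hyc hyl hδn)
      (legStepB_rdiv_mem_GcombSh (cE₂ * (Lc : ℝ) ^ (2 * (d + 1))) l hyc hyl hδn))
    (ruledClass_sub (halfSource_comb_legLetter_mem tabs cE cVH cΛ cE₂ cB Tc hBff hBmm hε (l + 1))
      (halfSource_comb_legLetter_mem tabs cE cVH cΛ cE₂ cB Tc hBff hBmm hε l))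

/-- NOT IN PRINT; OUR BOOKKEEPING.  **W1's `hKP` AT (III′): THE KERNEL-DRIFT LETTER OF THE COMB-CHART `ε`-MEMBER IS IN THE RULED CLASS AT EVERY LEVEL** (`|ε| ≤ 1`; the twin
of MY (E) `LegSourceRuledClass.halfKernelDrift_mem`): `legStepB … (l+1) (rdiv ∘ y_l) − legStepB … l (rdiv ∘ y_l) ∈ 𝒫` — `legStepB_rdiv_mem_GcombSh` at the steps `l+1` and `l`
on the member, `ruledClass_sub`. -/
theorem halfKernelDrift_comb_mem (tabs : SymTables d Lc) (cE cVH cΛ cE₂ cB : ℝ) (Tc : Fin 4 → Fin 4 → Fin 4 → Fin 4 → ℝ) {ε : ℝ} (hε : |ε| ≤ 1) (l : ℕ) :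
    (fun W : (Fin (d + 1) → (Fin (d + 1) → ℤ) → Fin (d + 1) → (Fin (d + 1) → ℤ) → MKer (d + 1) (Fib d)) =>
      (∀ (κ : Fin (d + 1)) (u : Fin (d + 1) → ℤ) (κ' : Fin (d + 1)) (u' t : Fin (d + 1) → ℤ),
          W κ (u + (Lc : ℤ) • t) κ' (u' + (Lc : ℤ) • t) = shiftK (-((Lc : ℤ) • t)) (W κ u κ' u')) ∧
      (∀ (N' : ℕ) (κ κ' : Fin (d + 1)) (a b : Fib d), zmode N' W κ κ' a b = 0) ∧
      (∃ C' δ' : ℝ, 0 < δ' ∧ LocStencil₂ W C' δ'))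
      (legStepB (fun _ : ℕ => -((cE₂ * (Lc : ℝ) ^ (2 * (d + 1))) * ((Lc : ℝ) ^ (d + 1))⁻¹)) (fun m => unitK (sfStep Lc m) (smStep d Lc m) (GcombSh (d := d) Lc m)) Lc (l + 1) (fun κ u κ' u' => rdiv ((((1 : ℝ) / 2) • (unitS₂ (sfStep Lc l) (smStep d Lc l) (T2RecOf d Lc (GcombSh Lc) (SpureCombOf tabs cE cVH cΛ) tabs.M cE₂ cB Tc tabs.vh₂S tabs.mixFF l) + ε • fun κ u κ' u' => sgnK (trK ((unitS₂ (sfStep Lc l) (smStep d Lc l) (T2RecOf d Lc (GcombSh Lc) (SpureCombOf tabs cE cVH cΛ) tabs.M cE₂ cB Tc tabs.vh₂S tabs.mixFF l)) κ u κ' u')))) κ u κ' u'))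
        - legStepB (fun _ : ℕ => -((cE₂ * (Lc : ℝ) ^ (2 * (d + 1))) * ((Lc : ℝ) ^ (d + 1))⁻¹)) (fun m => unitK (sfStep Lc m) (smStep d Lc m) (GcombSh (d := d) Lc m)) Lc l (fun κ u κ' u' => rdiv ((((1 : ℝ) / 2) • (unitS₂ (sfStep Lc l) (smStep d Lc l) (T2RecOf d Lc (GcombSh Lc) (SpureCombOf tabs cE cVH cΛ) tabs.M cE₂ cB Tc tabs.vh₂S tabs.mixFF l) + ε • fun κ u κ' u' => sgnK (trK ((unitS₂ (sfStep Lc l) (smStep d Lc l) (T2RecOf d Lc (GcombSh Lc) (SpureCombOf tabs cE cVH cΛ) tabs.M cE₂ cB Tc tabs.vh₂S tabs.mixFF l)) κ u κ' u')))) κ u κ' u'))) := by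
  obtain ⟨Cn, δn, hδn, hn⟩ := locStencil₂_unitS₂_T2RecOf_comb tabs cE cVH cΛ cE₂ cB Tc l
  have hyl : LocStencil₂ (((1 : ℝ) / 2) • (unitS₂ (sfStep Lc l) (smStep d Lc l) (T2RecOf d Lc (GcombSh Lc) (SpureCombOf tabs cE cVH cΛ) tabs.M cE₂ cB Tc tabs.vh₂S tabs.mixFF l) + ε • fun κ u κ' u' => sgnK (trK ((unitS₂ (sfStep Lc l) (smStep d Lc l) (T2RecOf d Lc (GcombSh Lc) (SpureCombOf tabs cE cVH cΛ) tabs.M cE₂ cB Tc tabs.vh₂S tabs.mixFF l)) κ u κ' u')))) Cn δn := fun κ u κ' u' => (locStencil₂_half hn hε) κ u κ' u'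
  have hyc := halfMember_comb_translate tabs cE cVH cΛ cE₂ cB Tc ε l
  exact ruledClass_sub (legStepB_rdiv_mem_GcombSh (cE₂ * (Lc : ℝ) ^ (2 * (d + 1))) (l + 1) hyc hyl hδn)
    (legStepB_rdiv_mem_GcombSh (cE₂ * (Lc : ℝ) ^ (2 * (d + 1))) l hyc hyl hδn)

/-- NOT IN PRINT; OUR BOOKKEEPING.  **W1's `hSP` AT (III′): THE SOURCE-DRIFT LETTER OF THE COMB-CHART `ε`-MEMBER IS IN THE RULED CLASS AT EVERY LEVEL** (`|ε| ≤ 1`; the twin of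
MY (E) `LegSourceRuledClass.halfSourceDrift_mem`): `rdiv ∘ F′^ε_{l+1} − rdiv ∘ F′^ε_l ∈ 𝒫` — `halfSource_comb_legLetter_mem` at `l+1` and `l`, `ruledClass_sub`. -/
theorem halfSourceDrift_comb_mem (tabs : SymTables d Lc) (cE cVH cΛ cE₂ cB : ℝ) (Tc : Fin 4 → Fin 4 → Fin 4 → Fin 4 → ℝ)
    (hBff : ∀ κ u κ' u' x z (α β : Fin (d + 1)), tabs.vh₂S κ u κ' u' x z (Sum.inl α) (Sum.inl β) = 0)
    (hBmm : ∀ κ u κ' u' x z (μ ν : Fin (d + 1)), tabs.vh₂S κ u κ' u' x z (Sum.inr μ) (Sum.inr ν) = 0) {ε : ℝ} (hε : |ε| ≤ 1) (l : ℕ) :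
    (fun W : (Fin (d + 1) → (Fin (d + 1) → ℤ) → Fin (d + 1) → (Fin (d + 1) → ℤ) → MKer (d + 1) (Fib d)) =>
      (∀ (κ : Fin (d + 1)) (u : Fin (d + 1) → ℤ) (κ' : Fin (d + 1)) (u' t : Fin (d + 1) → ℤ),
          W κ (u + (Lc : ℤ) • t) κ' (u' + (Lc : ℤ) • t) = shiftK (-((Lc : ℤ) • t)) (W κ u κ' u')) ∧
      (∀ (N' : ℕ) (κ κ' : Fin (d + 1)) (a b : Fib d), zmode N' W κ κ' a b = 0) ∧
      (∃ C' δ' : ℝ, 0 < δ' ∧ LocStencil₂ W C' δ'))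
      ((fun κ u κ' u' => rdiv ((((1 : ℝ) / 2) • ((fun κ u κ' u' => (cE₂ * (Lc : ℝ) ^ (2 * (d + 1))) • mmRead Lc (K3OfK (unitK (sfStep Lc (l + 1)) (smStep d Lc (l + 1)) (GcombSh (d := d) Lc (l + 1))) Lc (unitS (sfStep Lc (l + 1)) (smStep d Lc (l + 1)) (SpureCombOf tabs cE cVH cΛ (l + 1))) (unitM (sfStep Lc (l + 1)) (smStep d Lc (l + 1)) (tabs.M (l + 1))) (W2SymOfK (unitK (sfStep Lc (l + 1)) (smStep d Lc (l + 1)) (GcombSh (d := d) Lc (l + 1))) Lc (unitS (sfStep Lc (l + 1)) (smStep d Lc (l + 1)) (SpureCombOf tabs cE cVH cΛ (l + 1))) (unitM (sfStep Lc (l + 1)) (smStep d Lc (l + 1)) (tabs.M (l + 1))) 0 (unitM₂ (sfStep Lc (l + 1)) (smStep d Lc (l + 1)) (M2Of d Lc tabs.mixFF (l + 1)))) κ u κ' u') + cB • tabs.vh₂S κ u κ' u') + ε • fun κ u κ' u' => sgnK (trK (((fun κ u κ' u' => (cE₂ * (Lc : ℝ) ^ (2 * (d + 1))) • mmRead Lc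 (K3OfK (unitK (sfStep Lc (l + 1)) (smStep d Lc (l + 1)) (GcombSh (d := d) Lc (l + 1))) Lc (unitS (sfStep Lc (l + 1)) (smStep d Lc (l + 1)) (SpureCombOf tabs cE cVH cΛ (l + 1))) (unitM (sfStep Lc (l + 1)) (smStep d Lc (l + 1)) (tabs.M (l + 1))) (W2SymOfK (unitK (sfStep Lc (l + 1)) (smStep d Lc (l + 1)) (GcombSh (d := d) Lc (l + 1))) Lc (unitS (sfStep Lc (l + 1)) (smStep d Lc (l + 1)) (SpureCombOf tabs cE cVH cΛ (l + 1))) (unitM (sfStep Lc (l + 1)) (smStep d Lc (l + 1)) (tabs.M (l + 1))) 0 (unitM₂ (sfStep Lc (l + 1)) (smStep d Lc (l + 1)) (M2Of d Lc tabs.mixFF (l + 1)))) κ u κ' u') + cB • tabs.vh₂S κ u κ' u')) κ u κ' u')))) κ u κ' u')) - fun κ u κ' u' => rdiv ((((1 : ℝ) / 2) • ((fun κ u κ' u' => (cE₂ * (Lc : ℝ) ^ (2 * (d + 1))) • mmRead Lc (K3OfK (unitK (sfStep Lc l) (smStep d Lc l) (GcombSh (d := d) Lc l)) Lc (unitS (sfStep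 Lc l) (smStep d Lc l) (SpureCombOf tabs cE cVH cΛ l)) (unitM (sfStep Lc l) (smStep d Lc l) (tabs.M l)) (W2SymOfK (unitK (sfStep Lc l) (smStep d Lc l) (GcombSh (d := d) Lc l)) Lc (unitS (sfStep Lc l) (smStep d Lc l) (SpureCombOf tabs cE cVH cΛ l)) (unitM (sfStep Lc l) (smStep d Lc l) (tabs.M l)) 0 (unitM₂ (sfStep Lc l) (smStep d Lc l) (M2Of d Lc tabs.mixFF l))) κ u κ' u') + cB • tabs.vh₂S κ u κ' u') + ε • fun κ u κ' u' => sgnK (trK (((fun κ u κ' u' => (cE₂ * (Lc : ℝ) ^ (2 * (d + 1))) • mmRead Lc (K3OfK (unitK (sfStep Lc l) (smStep d Lc l) (GcombSh (d := d) Lc l)) Lc (unitS (sfStep Lc l) (smStep d Lc l) (SpureCombOf tabs cE cVH cΛ l)) (unitM (sfStep Lc l) (smStep d Lc l) (tabs.M l)) (W2SymOfK (unitK (sfStep Lc l) (smStep d Lc l) (GcombSh (d := d) Lc l)) Lc (unitS (sfStep Lc l) (smStep d Lc l) (SpureCombOf tabs cE cVH cΛ l)) (unitM (sfStep Lc l)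 (smStep d Lc l) (tabs.M l)) 0 (unitM₂ (sfStep Lc l) (smStep d Lc l) (M2Of d Lc tabs.mixFF l))) κ u κ' u') + cB • tabs.vh₂S κ u κ' u')) κ u κ' u')))) κ u κ' u')) :=
  ruledClass_sub (halfSource_comb_legLetter_mem tabs cE cVH cΛ cE₂ cB Tc hBff hBmm hε (l + 1))
    (halfSource_comb_legLetter_mem tabs cE cVH cΛ cE₂ cB Tc hBff hBmm hε l)

end Summit.QuantumFields.BalabanUV.Beta.GAN24.CombLegSourceRuledClass

end
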